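import Literature.AlgebraicGeometry.Frobenioids.Thm36SubInstancesA
import Literature.AlgebraicGeometry.Frobenioids.Thm36SubInstancesB
import Literature.AlgebraicGeometry.Frobenioids.Thm36SubModelProofs
import Literature.AlgebraicGeometry.Frobenioids.ArchimedeanFieldModel
import HarnessLib

/-!
# Frobenioids II, Theorem 3.6 (i), (iv), (vi), (ix), (x) — the schema predicates of
# `ArchimedeanBasicProperties.lean` CLOSED AT THE GENUINE CARRIERS of Example 3.3, part B (proof-only bridging file)

Mochizuki, *The geometry of Frobenioids II: poly-Frobenioids*, Kyushu J. Math. **62** (2008) 401–460, §3,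
Example 3.3 pp. 27–29 and Theorem 3.6 pp. 36–39 (author's kurims text; item (i) p. 36 l. 37, (iv) p. 37 l. 18,
(vi) p. 37 l. 31, (ix) p. 38 l. 8, (x) p. 38 l. 11; proof p. 38 l. 12 – p. 39 l. 25)
[cite: MochizukiFrdII2008, Thm 3.6 pp.36-38].

WHY THIS FILE (abc-iut cell, D-0079 sub-cell L-F [FrdI/II], table `plan/L1/LF-FRD.tsv` pack A; seat
abc-iut-f-012 gen 7; companion of part A = `ArchimedeanBasicPropertiesGenuineInstances.lean`, seat abc-iut-f-009).
The statements of `ArchimedeanBasicProperties.lean` (seat abc-iut-L1-t9) are SCHEMA predicates `ArchFrd.Thm36…`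
binding the structure functor `F` (and `Λ`, the base `G : D → D₀`, …) freely; their universal closures are refuted
in the tree (`ArchimedeanBasicPropertiesSchemaNegative*.lean`), and the printed claims are the instantiations at the
categories of Example 3.3 over an ARBITRARY base `π : D → D₀`: `F := C.toElem π` (`C^ℤ = C = C₀ ×_{D₀} D`), THE
perfection `C^ℚ := C^pf` (`Thm36Sub.pfStr π hF`, [FrdI] Def. 3.1 (iii), under `hF :` "`C` is a Frobenioid",
Ex. 3.3 (ii) — discharged for connected, totally epimorphic `D` by `ArchFrd.Ex33ii_isFrobenioid_holds`), THE
realification `C^ℝ := C^rlf` (`Thm36Sub.rlfStr π`, [FrdI] Prop. 5.3), and the angular Frobenioid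
`F := A.toElem π`.  Every one of these instance forms is ALREADY PROVED in the tree, but at `C^pf` / `C^rlf` the
closers of record conclude in the SLOT definitions of `Thm36Sub.lean` (`istrTypes_Q`, `istrTypes_R`, `istrAll_Q`,
`istrAll_R`, `untrEquiv_Z`, `untrEquiv_R`, `ivFactors_Q`, `ivFactors_R`, `vi_Q`, `vi_R`, `ix_Q`, `ix_R`, `x_R`)
or in the all-`Λ` instance statements of `ArchimedeanTheoremsInstances.lean` (`Thm36i_istrTypes_C`, …), and at
`C^ℤ` the "model type" closer concludes in the wrapper `Thm36i_istrModel_C` — never in the schema predicate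
itself.  This file re-heads them, ONE LINE EACH, so that each FACT-LIST row below has a kernel theorem whose
conclusion head IS the row's declaration at each genuine carrier (the cell's head-matcher reads heads mechanically):

* F-0691 `Thm36i_istrModel` (Thm. 3.6 (i) "model type") at `C^ℤ` — at `C^pf` / `C^rlf` the closers
  `Thm36Sub.istrModel_Q_holds` (`Thm36SubPfModelQ.lean`) / `Thm36Sub.istrModel_R_holds` (`Thm36SubRlfModel.lean`)
  already conclude in `Thm36i_istrModel` and are not restated;
* F-0692 `Thm36i_istrTypes` (Thm. 3.6 (i) "isotropic, base-trivial type") at `C^pf`, `C^rlf`, all `Λ`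
  (`C^ℤ`: `thm36i_istrTypes_C'`, `ArchimedeanIstrProofs.lean`; `A`: `thm36i_istrTypes_A`, `ArchimedeanAngularIstr.lean`);
* F-0693 `Thm36i_untrEquiv` (Thm. 3.6 (i) "`(C^Λ)^un-tr ⥲ C^ℝ`") at `Λ = ℤ` and `Λ = ℝ` (`Λ = ℚ`:
  `Thm36Sub.untrEquiv_Q_holds`, `Thm36SubPerfectionUntrEquiv.lean`, already concludes in `Thm36i_untrEquiv`);
* F-0780 `Thm36i_istr_all` (Thm. 3.6 (i) "If `Λ ≥ ℚ`, then `(C^Λ)^istr = C^Λ`") at `C^ℤ` (vacuous), `C^pf`,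
  `C^rlf`, all `Λ`;
* F-0785 `Thm36iv_factors` (Thm. 3.6 (iv), first sentence) at `C^pf`, `C^rlf`, all `Λ` (`C^ℤ` / `A`:
  `thm36iv_factors_C` / `thm36iv_factors_A`, `ArchimedeanAutActionFactors.lean`);
* F-0696 `Thm36vi` (Thm. 3.6 (vi)) at `C^pf`, `C^rlf`, all `Λ` (`C` / `A`: `thm36vi_C` / `thm36vi_A`,
  `ArchimedeanPseudoTerminal.lean`);
* F-0788 `Thm36ix` (Thm. 3.6 (ix)) at `C^pf`, `C^rlf`, all `Λ` (`C^ℤ` / `A`: `Indissect.thm36ix_C` /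
  `Indissect.thm36ix_A`, `ArchimedeanIndissectibleAngular.lean`; `thm36ix_CA_Z` / `thm36ix_CA_A`,
  `ArchimedeanDissectionProofs.lean`);
* F-0697 `Thm36x` (Thm. 3.6 (x)) at `C^rlf` and, for every perfection datum, all `Λ` (`C` / `A` / `Λ = ℚ`:
  `Slim.thm36x_C`, `ArchimedeanSlim.lean`; `Slim.thm36x_A`, `ArchimedeanSlimAngular.lean`; `Slim.thm36x_Q`).

(F-1299 `Thm36vii_recover`, Thm. 3.6 (vii), `Λ = ℤ` only in print: `thm36vii_recover_C` / `thm36vii_recover_A`,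
`ArchimedeanBoundaryRecover.lean`, already conclude in the schema predicate — nothing to re-head.)

PROOF-ONLY: no `def`, no new `Prop`, no restated schema; every theorem is a term of an existing theorem
(seats abc-iut-w4-d074, w5-d161, w5-d190, w5-d036, L1-d5, w5-d103, L1-t6, L1-t9 — cited at each declaration).
Honest framing: FACT rows are assumption LABELS on OUR typed statements of the refereed [FrdII]; "proved" = OUR
kernel check of OUR typed instance form; nothing here asserts abc proved or refuted; no side taken on
[IUTchIII] Cor. 3.12; typed ≠ proved.
-/

noncomputable section

namespace Literature.AlgebraicGeometry.Frobenioids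

open CategoryTheory Opposite

universe v u

namespace ArchFrd

variable {D : Type u} [Category.{v} D] (π : D ⥤ D0)

/-! ### Theorem 3.6 (i), "model type", at `C^ℤ` (F-0691) -/

/-- **Thm. 3.6 (i)**, "model type" clause, AT THE GENUINE CARRIER `F := C.toElem π`, `Λ = ℤ` (FACT row F-0691
`Thm36i_istrModel`): "`(C^Λ)^istr` is of […] model type, with rational function monoid naturally isomorphic to
`(Φ^fld)^Λ`" (p. 36) — `C^istr` is equivalent over `F_Φ` to the model Frobenioid of the datum `Φ^fld → Φ^gp`;
re-headed from `thm36i_istrModel_C` (`ArchimedeanFieldModel.lean`, seat abc-iut-w5-d103), over any base `π`.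
[cite: MochizukiFrdII2008, Thm 3.6 (i) p.36] -/
theorem thm36i_istrModel_inst_C :
    Thm36i_istrModel (C.toElem π)
      (ModelFrobenioid.toElem (Φ π) (fieldMonoid (Φ π) π) (fieldMonoidToGp (Φ π) π)) :=
  thm36i_istrModel_C π

/-! ### Theorem 3.6 (i), "isotropic, base-trivial type", at `C^pf`, `C^rlf`, all `Λ` (F-0692) -/

/-- **Thm. 3.6 (i)**, first clauses, AT THE perfection `C^ℚ := C^pf` (FACT row F-0692 `Thm36i_istrTypes`):
"The Frobenioid `(C^Λ)^istr` is of isotropic, base-trivial […] type" (p. 36), `Λ = ℚ` — re-headed from the slot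
closer `Thm36Sub.istrTypes_Q_holds` (`Thm36SubIstrTypesQ.lean`, seat abc-iut-w5-d161).
[cite: MochizukiFrdII2008, Thm 3.6 (i) p.36] -/
theorem thm36i_istrTypes_inst_pf (hF : PreFrobenioid.IsFrobenioid (C.toElem π)) :
    Thm36i_istrTypes (Thm36Sub.pfStr π hF) :=
  Thm36Sub.istrTypes_Q_holds π hF

/-- **Thm. 3.6 (i)**, first clauses, AT THE realification `C^ℝ := C^rlf` (F-0692, `Λ = ℝ`) — re-headed from
`Thm36Sub.istrTypes_R_holds` (`Thm36SubProofs3.lean`, seat abc-iut-w4-d074). [cite: MochizukiFrdII2008, Thm 3.6 (i) p.36] -/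
theorem thm36i_istrTypes_inst_rlf : Thm36i_istrTypes (Thm36Sub.rlfStr π) :=
  Thm36Sub.istrTypes_R_holds π

/-- **Thm. 3.6 (i)**, first clauses, for EVERY `Λ ∈ {ℤ, ℚ, ℝ}` at THE completion data
`(pfCompletion π hF, rlfCompletion π)` (F-0692; the `Λ`-th conjunct of abc-iut-L1-t9's `Thm36i_istrTypes_C`,
closed by `Thm36Sub.thm36i_istrTypes_C_holds`, `Thm36SubInstancesA.lean`). [cite: MochizukiFrdII2008, Thm 3.6 (i) p.36] -/
theorem thm36i_istrTypes_inst_all (hF : PreFrobenioid.IsFrobenioid (C.toElem π)) (Λ : MonoidType) :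
    Thm36i_istrTypes (archFrobenioid π (Thm36Sub.pfCompletion π hF) (Thm36Sub.rlfCompletion π) Λ).str :=
  Thm36Sub.thm36i_istrTypes_C_holds π hF Λ

/-! ### Theorem 3.6 (i), "`(C^Λ)^un-tr ⥲ C^ℝ`", at `Λ = ℤ` and `Λ = ℝ` (F-0693) -/

/-- **Thm. 3.6 (i)** AT `Λ = ℤ` (FACT row F-0693 `Thm36i_untrEquiv`): "For arbitrary `Λ`, there is a natural
equivalence of categories `(C^Λ)^un-tr ⥲ C^ℝ`, compatible with the Frobenioid structures" (p. 36) — the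
unit-trivialisation of `C` in its model description ([FrdI] Prop. 5.3), read in `F_{Φ^rlf}`, is equivalent over
`F_{Φ^rlf}` to THE realification; re-headed from `Thm36Sub.untrEquiv_Z_holds` (`Thm36SubModelProofs.lean`, seat
abc-iut-w4-d074). [cite: MochizukiFrdII2008, Thm 3.6 (i) p.36] -/
theorem thm36i_untrEquiv_inst_Z :
    Thm36i_untrEquiv
      (ModelFrobenioid.toElem (Φ π) (PreFrobenioid.biratSubfunctor (C.toElem π)).toMonoid
          (PreFrobenioid.biratSubfunctor (C.toElem π)).incl ⋙
        ElemFrobenioid.mapNatTrans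
          (RealificationData.canonical (Φ π) (PreFrobenioid.IsPerfFactorialOn.op (isPerfFactorialOn_Φ π))).toRlf)
      (Thm36Sub.rlfStr π) :=
  Thm36Sub.untrEquiv_Z_holds π

/-- **Thm. 3.6 (i)** AT `Λ = ℝ` (F-0693): the unit-trivialisation of `C^ℝ = C^rlf` in its model description is
equivalent over `F_{Φ^rlf}` to `C^rlf` itself; re-headed from `Thm36Sub.untrEquiv_R_holds`
(`Thm36SubModelProofs.lean`, seat abc-iut-w4-d074). (`Λ = ℚ`: `Thm36Sub.untrEquiv_Q_holds`,
`Thm36SubPerfectionUntrEquiv.lean`, already concludes in `Thm36i_untrEquiv`.) [cite: MochizukiFrdII2008, Thm 3.6 (i) p.36] -/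
theorem thm36i_untrEquiv_inst_rlf :
    Thm36i_untrEquiv
      (ModelFrobenioid.toElem
        (Literature.AnabelianGeometry.EtaleTheta.rlfFunctor (Φ π)
          (PreFrobenioid.IsPerfFactorialOn.op (isPerfFactorialOn_Φ π)))
        (PreFrobenioid.biratSubfunctor (Thm36Sub.rlfStr π)).toMonoid
        (PreFrobenioid.biratSubfunctor (Thm36Sub.rlfStr π)).incl)
      (Thm36Sub.rlfStr π) :=
  Thm36Sub.untrEquiv_R_holds π

/-! ### Theorem 3.6 (i), "If `Λ ≥ ℚ`, then `(C^Λ)^istr = C^Λ`", at `C^ℤ`, `C^pf`, `C^rlf`, all `Λ` (F-0780) -/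

/-- **Thm. 3.6 (i)** AT `C^ℤ` (FACT row F-0780 `Thm36i_istr_all`): "If `Λ ≥ ℚ`, then `(C^Λ)^istr = C^Λ`" (p. 36)
is VACUOUS at `Λ = ℤ` (the typed guard `Λ ≠ ℤ` fails). [cite: MochizukiFrdII2008, Thm 3.6 (i) p.36] -/
theorem thm36i_istr_all_inst_C : Thm36i_istr_all (C.toElem π) .Z :=
  fun h => absurd rfl h

/-- **Thm. 3.6 (i)** AT THE perfection `C^ℚ := C^pf` (F-0780, `Λ = ℚ`): every object of `C^pf` is isotropic —
re-headed from `Thm36Sub.istrAll_Q_holds` (`Thm36SubProofs.lean`, seat abc-iut-w4-d074).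
[cite: MochizukiFrdII2008, Thm 3.6 (i) p.36] -/
theorem thm36i_istr_all_inst_pf (hF : PreFrobenioid.IsFrobenioid (C.toElem π)) :
    Thm36i_istr_all (Thm36Sub.pfStr π hF) .Q :=
  Thm36Sub.istrAll_Q_holds π hF

/-- **Thm. 3.6 (i)** AT THE realification `C^ℝ := C^rlf` (F-0780, `Λ = ℝ`): every object of `C^rlf` is
isotropic — re-headed from `Thm36Sub.istrAll_R_holds` (`Thm36SubProofs.lean`, seat abc-iut-w4-d074).
[cite: MochizukiFrdII2008, Thm 3.6 (i) p.36] -/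
theorem thm36i_istr_all_inst_rlf : Thm36i_istr_all (Thm36Sub.rlfStr π) .R :=
  Thm36Sub.istrAll_R_holds π

/-- **Thm. 3.6 (i)** "`Λ ≥ ℚ ⇒ (C^Λ)^istr = C^Λ`" for EVERY `Λ` at THE completion data (F-0780; the `Λ`-th
conjunct of abc-iut-L1-t9's `Thm36i_istr_all_C`, closed by `Thm36Sub.thm36i_istr_all_C_holds`,
`Thm36SubInstancesA.lean`). [cite: MochizukiFrdII2008, Thm 3.6 (i) p.36] -/
theorem thm36i_istr_all_inst_all (hF : PreFrobenioid.IsFrobenioid (C.toElem π)) (Λ : MonoidType) :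
    Thm36i_istr_all (archFrobenioid π (Thm36Sub.pfCompletion π hF) (Thm36Sub.rlfCompletion π) Λ).str Λ :=
  Thm36Sub.thm36i_istr_all_C_holds π hF Λ

/-! ### Theorem 3.6 (iv), first sentence, at `C^pf`, `C^rlf`, all `Λ` (F-0785) -/

/-- **Thm. 3.6 (iv)**, first sentence, AT THE perfection `C^ℚ := C^pf` (FACT row F-0785 `Thm36iv_factors`):
"the natural action of `Aut_F(A)` on `O^▷(A), O^×(A)` factors through `Aut_{D₀}(A₀)`" (p. 37) — re-headed from
`Thm36Sub.ivFactors_Q_holds` (`Thm36SubAutActionQ.lean`, seat abc-iut-w5-d190).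
[cite: MochizukiFrdII2008, Thm 3.6 (iv) p.37] -/
theorem thm36iv_factors_inst_pf (hF : PreFrobenioid.IsFrobenioid (C.toElem π)) :
    Thm36iv_factors (baseRC π) (Thm36Sub.pfStr π hF) :=
  Thm36Sub.ivFactors_Q_holds π hF

/-- **Thm. 3.6 (iv)**, first sentence, AT THE realification `C^ℝ := C^rlf` (F-0785) — re-headed from
`Thm36Sub.ivFactors_R_holds` (`Thm36SubAutActionR.lean`, seat abc-iut-L1-d5). [cite: MochizukiFrdII2008, Thm 3.6 (iv) p.37] -/
theorem thm36iv_factors_inst_rlf : Thm36iv_factors (baseRC π) (Thm36Sub.rlfStr π) :=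
  Thm36Sub.ivFactors_R_holds π

/-- **Thm. 3.6 (iv)**, first sentence, for EVERY `Λ` at THE completion data (F-0785; the `Λ`-th conjunct of
abc-iut-L1-t9's `Thm36iv_C`, closed by `Thm36Sub.thm36iv_C_holds`, `Thm36SubInstancesA.lean`).
[cite: MochizukiFrdII2008, Thm 3.6 (iv) p.37] -/
theorem thm36iv_factors_inst_all (hF : PreFrobenioid.IsFrobenioid (C.toElem π)) (Λ : MonoidType) :
    Thm36iv_factors (baseRC π) (archFrobenioid π (Thm36Sub.pfCompletion π hF) (Thm36Sub.rlfCompletion π) Λ).str :=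
  Thm36Sub.thm36iv_C_holds π hF Λ

/-! ### Theorem 3.6 (vi), pseudo-terminal objects, at `C^pf`, `C^rlf`, all `Λ` (F-0696) -/

/-- **Thm. 3.6 (vi)** AT THE perfection `C^ℚ := C^pf` (FACT row F-0696 `Thm36vi`): "If `D` admits a
pseudo-terminal object, then `F` admits a pseudo-terminal object" (p. 37) — re-headed from `Thm36Sub.vi_Q_holds`
(`Thm36SubProofs.lean`, seat abc-iut-w4-d074). [cite: MochizukiFrdII2008, Thm 3.6 (vi) p.37] -/
theorem thm36vi_inst_pf (hF : PreFrobenioid.IsFrobenioid (C.toElem π)) : Thm36vi D (Thm36Sub.pfCat π hF) :=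
  Thm36Sub.vi_Q_holds π hF

/-- **Thm. 3.6 (vi)** AT THE realification `C^ℝ := C^rlf` (F-0696) — re-headed from `Thm36Sub.vi_R_holds`
(`Thm36SubProofs2.lean`, seat abc-iut-w4-d074). [cite: MochizukiFrdII2008, Thm 3.6 (vi) p.37] -/
theorem thm36vi_inst_rlf : Thm36vi D (Thm36Sub.rlfCat π) :=
  Thm36Sub.vi_R_holds π

/-- **Thm. 3.6 (vi)** for EVERY `Λ` at THE completion data (F-0696; the `C^Λ`-conjunct of abc-iut-L1-t9's
`Thm36vi_CA`, closed by `Thm36Sub.thm36vi_CA_holds`, `Thm36SubInstancesA.lean`; the `A`-conjunct is `thm36vi_A`).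
[cite: MochizukiFrdII2008, Thm 3.6 (vi) p.37] -/
theorem thm36vi_inst_all (hF : PreFrobenioid.IsFrobenioid (C.toElem π)) (Λ : MonoidType) :
    Thm36vi D (archFrobenioid π (Thm36Sub.pfCompletion π hF) (Thm36Sub.rlfCompletion π) Λ).cat :=
  (Thm36Sub.thm36vi_CA_holds π hF).1 Λ

/-! ### Theorem 3.6 (ix), strong indissectibility, at `C^pf`, `C^rlf`, all `Λ` (F-0788) -/

/-- **Thm. 3.6 (ix)** AT THE perfection `C^ℚ := C^pf` (FACT row F-0788 `Thm36ix`): "Suppose that `D` is of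
strongly indissectible type. If `D` is not complexifiable, then we assume further that `Λ ≠ ℤ`. Then `F^istr` is
of strongly indissectible type" (p. 38), `Λ = ℚ` — re-headed from `Thm36Sub.ix_Q_holds` (`Thm36SubIxQ.lean`,
seat abc-iut-w5-d036). [cite: MochizukiFrdII2008, Thm 3.6 (ix) p.38] -/
theorem thm36ix_inst_pf (hF : PreFrobenioid.IsFrobenioid (C.toElem π)) :
    Thm36ix (baseRC π) (Thm36Sub.pfStr π hF) .Q :=
  Thm36Sub.ix_Q_holds π hF

/-- **Thm. 3.6 (ix)** AT THE realification `C^ℝ := C^rlf` (F-0788, `Λ = ℝ`) — re-headed from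
`Thm36Sub.ix_R_holds` (`Thm36SubIndissectR.lean`, seat abc-iut-L1-d5). [cite: MochizukiFrdII2008, Thm 3.6 (ix) p.38] -/
theorem thm36ix_inst_rlf : Thm36ix (baseRC π) (Thm36Sub.rlfStr π) .R :=
  Thm36Sub.ix_R_holds π

/-- **Thm. 3.6 (ix)** for EVERY `Λ` at THE completion data (F-0788; the `C^Λ`-conjunct of abc-iut-L1-t9's
`Thm36ix_CA`, closed by `Thm36Sub.thm36ix_CA_holds`, `Thm36SubInstancesB.lean`; the `A`-conjunct is
`thm36ix_CA_A`). [cite: MochizukiFrdII2008, Thm 3.6 (ix) p.38] -/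
theorem thm36ix_inst_all (hF : PreFrobenioid.IsFrobenioid (C.toElem π)) (Λ : MonoidType) :
    Thm36ix (baseRC π) (archFrobenioid π (Thm36Sub.pfCompletion π hF) (Thm36Sub.rlfCompletion π) Λ).str Λ :=
  (Thm36Sub.thm36ix_CA_holds π hF).1 Λ

/-! ### Theorem 3.6 (x), slimness, at `C^rlf` and all `Λ` (F-0697) -/

/-- **Thm. 3.6 (x)** AT THE realification `C^ℝ := C^rlf` (FACT row F-0697 `Thm36x`): "If `D` is slim, and
`Λ ∈ {ℤ, ℝ}`, then `F` is also slim" (p. 38), `Λ = ℝ` — re-headed from `Thm36Sub.x_R_holds` (`Thm36SubSlim.lean`,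
seat abc-iut-w4-d074). (`Λ = ℚ` is vacuous: `Slim.thm36x_Q`; `C^ℤ` / `A`: `Slim.thm36x_C` / `Slim.thm36x_A`.)
[cite: MochizukiFrdII2008, Thm 3.6 (x) p.38] -/
theorem thm36x_inst_rlf : Thm36x .R D (Thm36Sub.rlfCat π) :=
  Thm36Sub.x_R_holds π

/-- **Thm. 3.6 (x)** for EVERY `Λ`, at ANY perfection datum `pf` and THE realification (F-0697; the
`C^Λ`-conjunct of abc-iut-L1-t9's `Thm36x_CA`, closed by `Thm36Sub.thm36x_CA_holds`, `Thm36SubInstancesB.lean` —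
the `Λ = ℚ` conjunct is vacuous, so no hypothesis on `pf` is needed). [cite: MochizukiFrdII2008, Thm 3.6 (x) p.38] -/
theorem thm36x_inst_all (pf : LambdaCompletion π) (Λ : MonoidType) :
    Thm36x Λ D (archFrobenioid π pf (Thm36Sub.rlfCompletion π) Λ).cat :=
  (Thm36Sub.thm36x_CA_holds π pf).1 Λ

end ArchFrd

end Literature.AlgebraicGeometry.Frobenioids

end
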